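import Literature.NumberTheory.Automorphic.DeuringTypeNumberFormula
import Literature.NumberTheory.Automorphic.BrandtModuleMultiplicativity
import HarnessLib

/-!
# Conjugacy classes of maximal orders of a definite quaternion algebra over `ℚ`: the type set classifies them, and the
# maximal orders of `B_{p,∞}` are all conjugate iff `p ∈ {2, 3, 5, 7, 13}`

For a Brandt setup `S : XiSetup 1 N⁻` (a maximal order `O` of a definite quaternion algebra `D` over `ℚ`), the tree's type set
`Typ O = Brandt.TypeSet O` (the classes `[I] ∈ Cls O` up to conjugacy of their left orders `O_L(I)`, `BrandtTypeSet.lean`) is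
identified with **the set of conjugacy classes of maximal orders of `D`** — Voight 17.4.1 (orders of the same type =
isomorphic = conjugate), Lemma 17.4.13 (`[I] ↦ O_L(I)` is surjective onto the types of orders connected to `O`) and the
connectedness of maximal orders (every maximal order is `O_L(I)` for a right `O`-ideal `I`, Vignéras III §5):

* §1 `XiSetup.isMaximalOrder_leftOrder_rep` (every `O_L(I_c)` is maximal), `XiSetup.exists_mem_rightIdeals_leftOrder_eq_of_isMaximalOrder`,
  `XiSetup.exists_sameType_leftOrder_rep_of_isMaximalOrder` (every maximal order is conjugate to some `O_L(I_c)`),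
  `XiSetup.isMaximalOrder_of_sameType`, `SameType.natCard_reducedNorm_eq` (conjugate orders have the same representation
  numbers) and `XiSetup.matrix_diag_eq_of_typeOf_eq` (the diagonal Brandt entries `T(n)_{cc}` are type invariants),
  **`XiSetup.natCard_typeSet_eq_natCard_conjClasses`**: `# Typ O = #{ {O'' : O'' ≃ O'} : O' ⊂ D maximal }`,
  `XiSetup.subsingleton_typeSet_iff_forall_isMaximalOrder` / `…_iff_forall_sameType` (type number one ⟺ all maximal orders
  conjugate), `XiSetup.natCard_conjClasses_le_natCard_classSet` (`≤ # Cls O`).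
* §2 (prime discriminant, with `DeuringTypeNumberFormula.lean`) **`XiSetup.forall_isMaximalOrder_sameType_iff`:
  all maximal orders of `B_{p,∞}` are conjugate ⟺ `p ∈ {2, 3, 5, 7, 13}`** (pairwise form `XiSetup.forall_sameType_iff`;
  `XiSetup.exists_isMaximalOrder_not_sameType` otherwise); `XiSetup.add_eleven_le_twentyFour_mul_natCard_typeSet`
  (`24 t ≥ p + 11`); the number of conjugacy classes of maximal orders of `B_{p,∞}` is Deuring's
  `½ # Cls O + ¼([h(-p)] + h(-4p))` (`XiSetup.natCard_conjClasses_eq_deuring`, `…_eichler`).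
* §3 examples: `p = 11` (two classes, two non-conjugate maximal orders), `p = 37` (`# Cls O = 3`, two conjugacy classes).

The tree previously had the five individual "type number one" files (`HurwitzOrderTypeNumberOne`, `MaximalOrderDisc{Three,
Five,Seven,Thirteen}TypeNumberOne`) and the class-number-one ⟹ type-number-one implication
(`BrandtTypeNumberOneOfClassNumberOne`); the iff and the identification of `Typ O` with conjugacy classes are new.

## References

* [Voight2021] J. Voight, *Quaternion Algebras*, GTM 288: 17.4.1, Lemma 17.4.13, Cor. 17.4.14, §25.4, Prop. 30.9.2.
* [VignerasLNM800] M.-F. Vignéras, *Arithmétique des algèbres de quaternions*, LNM 800: Ch. I §1 Lemme 1.1, §4 Cor. 4.11;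
  Ch. III §5.
-/

noncomputable section

open scoped Pointwise

namespace Literature.NumberTheory.Automorphic

open HeckeTraceFormulaGL2Level
open Literature.NumberTheory.QuadraticFields.Quadratic

namespace Brandt

/-! ## §1 The type set classifies the maximal orders up to conjugacy -/

section General

variable {Nminus : ℕ} (S : XiSetup 1 Nminus)

/-- The order `O` of a setup of type `(1, N⁻)` is a maximal order. [cite: Voight2021, Def. 23.4.1 and 23.4.3] -/
theorem XiSetup.isMaximalOrder_O : IsMaximalOrder S.D S.O :=
  isMaximalZOrder_iff_isMaximalOrder.mp S.isMaximalZOrder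

/-- **The left orders `O_L(I_c)` of the right ideal classes of a maximal order are maximal orders.** [cite: Voight2021, Lemma 17.4.13 and 16.6.11] -/
theorem XiSetup.isMaximalOrder_leftOrder_rep (c : ClassSet S.O) : IsMaximalOrder S.D (leftOrder c.rep) :=
  haveI := S.isAddTorsionFree
  IsMaximalOrder.isMaximalOrder_leftOrder S.isMaximalOrder_O c.rep_mem

/-- **Every maximal order of `D` is the left order `O_L(I)` of a right ideal `I` of `O`** (maximal orders are connected).
[cite: Voight2021, Lemma 17.4.13 and Cor. 17.4.14] [cite: VignerasLNM800, Ch. III §5 (after Cor. 5.5)] -/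
theorem XiSetup.exists_mem_rightIdeals_leftOrder_eq_of_isMaximalOrder {O' : Submodule ℤ S.D} (hO' : IsMaximalOrder S.D O') :
    ∃ I ∈ rightIdeals S.O, leftOrder I = O' :=
  S.exists_mem_rightIdeals_leftOrder_eq one_ne_zero
    (isEichlerOrder_iff_brandt.mp (isMaximalZOrder_iff_isMaximalOrder.mpr hO').isEichlerOrder_one)

/-- **Every maximal order of `D` has the type of some class**: `∃ c ∈ Cls O`, `O' ≃ O_L(I_c)` (the map `Cls O → Typ O` hits
every maximal order). [cite: Voight2021, Lemma 17.4.13] -/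
theorem XiSetup.exists_sameType_leftOrder_rep_of_isMaximalOrder {O' : Submodule ℤ S.D} (hO' : IsMaximalOrder S.D O') :
    ∃ c : ClassSet S.O, SameType (leftOrder c.rep) O' :=
  S.exists_sameType_leftOrder_rep one_ne_zero
    (isEichlerOrder_iff_brandt.mp (isMaximalZOrder_iff_isMaximalOrder.mpr hO').isEichlerOrder_one)

/-- Orders of the same type as (i.e. conjugate to) a maximal order are maximal orders. [cite: Voight2021, 17.4.1 and Lemma 17.4.13] -/
theorem XiSetup.isMaximalOrder_of_sameType {O' O'' : Submodule ℤ S.D} (hO' : IsMaximalOrder S.D O') (h : SameType O' O'') :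
    IsMaximalOrder S.D O'' := by
  haveI := S.isAddTorsionFree
  obtain ⟨I, hI, rfl⟩ := S.exists_mem_rightIdeals_leftOrder_eq_of_isMaximalOrder hO'
  obtain ⟨β, rfl⟩ := h.exists_eq_leftOrder_smul
  exact IsMaximalOrder.isMaximalOrder_leftOrder S.isMaximalOrder_O
    (Brandt.units_smul_mem_rightIdeals_of_isTotallyDefinite S.isTotallyDefinite S.isEichlerOrder.isOrder hI β)

/-- For maximal orders, "same type" is detected on the classes: `O_L(I_c) ≃ O_L(I_{c'}) ⟺ typeOf c = typeOf c'` (restated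
from `BrandtTypeSet`). [cite: Voight2021, Lemma 17.4.13] -/
theorem XiSetup.sameType_leftOrder_rep_iff (c c' : ClassSet S.O) :
    SameType (leftOrder c.rep) (leftOrder c'.rep) ↔ typeOf S.O c = typeOf S.O c' :=
  typeOf_eq_typeOf_iff.symm

/-- **Conjugate orders have the same representation numbers**: `#{x ∈ β O' β⁻¹ : nrd x = q} = #{x ∈ O' : nrd x = q}`
(`x ↦ β⁻¹ x β`; the reduced norm is a class function). [cite: VignerasLNM800, Ch. I §1 Lemme 1.1] [cite: Voight2021, 17.4.1] -/
theorem SameType.natCard_reducedNorm_eq {Nplus Nminus : ℕ} (S : XiSetup Nplus Nminus) {O' O'' : Submodule ℤ S.D}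
    (h : SameType O' O'') (q : ℚ) :
    Nat.card {x : S.D // x ∈ O'' ∧ reducedNorm ℚ S.D x = q} = Nat.card {x : S.D // x ∈ O' ∧ reducedNorm ℚ S.D x = q} := by
  obtain ⟨β, rfl⟩ := h
  have hconj : ∀ y : S.D, ((β⁻¹ : S.Dˣ) : S.D) * ((β : S.D) * y * ((β⁻¹ : S.Dˣ) : S.D)) * β = y := fun y => by
    rw [← mul_assoc, ← mul_assoc, Units.inv_mul, one_mul, mul_assoc, Units.inv_mul, mul_one]
  have hconj' : ∀ x : S.D, (β : S.D) * (((β⁻¹ : S.Dˣ) : S.D) * x * β) * ((β⁻¹ : S.Dˣ) : S.D) = x := fun x => by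
    rw [← mul_assoc, ← mul_assoc, Units.mul_inv, one_mul, mul_assoc, Units.mul_inv, mul_one]
  have hn1 : ∀ x : S.D, reducedNorm ℚ S.D (((β⁻¹ : S.Dˣ) : S.D) * x * β) = reducedNorm ℚ S.D x := fun x => by
    have := reducedNorm_units_conj ℚ S.D β⁻¹ x
    rwa [inv_inv] at this
  have hn2 : ∀ y : S.D, reducedNorm ℚ S.D ((β : S.D) * y * ((β⁻¹ : S.Dˣ) : S.D)) = reducedNorm ℚ S.D y := fun y =>
    reducedNorm_units_conj ℚ S.D β y
  exact Nat.card_congr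
    { toFun := fun x => ⟨((β⁻¹ : S.Dˣ) : S.D) * x.1 * β, mem_units_conj_iff.mp x.2.1, (hn1 x.1).trans x.2.2⟩
      invFun := fun y => ⟨(β : S.D) * y.1 * ((β⁻¹ : S.Dˣ) : S.D),
        mem_units_conj_iff.mpr (by rw [hconj]; exact y.2.1), (hn2 y.1).trans y.2.2⟩
      left_inv := fun x => Subtype.ext (hconj' x.1)
      right_inv := fun y => Subtype.ext (hconj y.1) }

/-- **The diagonal Brandt entries are type invariants**: `typeOf c = typeOf c' ⟹ T(n)_{cc} = T(n)_{c'c'}` (`n ≠ 0`), as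
`2 w_c T(n)_{cc} = #{x ∈ O_L(I_c) : nrd x = n}` and both the unit index and the representation numbers are conjugation
invariants. [cite: Voight2021, 17.4.1 and 41.1.3] [cite: VignerasLNM800, Ch. V §2 (the diagonal terms)] -/
theorem XiSetup.matrix_diag_eq_of_typeOf_eq {Nplus Nminus : ℕ} (S : XiSetup Nplus Nminus) {n : ℕ} (hn : n ≠ 0)
    {c c' : ClassSet S.O} (h : typeOf S.O c = typeOf S.O c') : matrix S.O n c c = matrix S.O n c' c' := by
  have hw := weight_eq_weight_of_typeOf_eq h
  have h1 := S.two_mul_weight_mul_matrix_diag hn c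
  have h2 := S.two_mul_weight_mul_matrix_diag hn c'
  rw [(SameType.natCard_reducedNorm_eq S (typeOf_eq_typeOf_iff.mp h) (n : ℚ)), ← h1, ← hw] at h2
  have hwpos : (2 * weight S.O c : ℤ) ≠ 0 := by
    have := S.weight_pos c (S.finite_units c); positivity
  exact (mul_left_cancel₀ hwpos h2).symm

/-- **`Typ O` is in bijection with the set of conjugacy classes of maximal orders of `D`**: the number of types equals the
number of distinct classes `{O'' : O'' ≃ O'}`, `O'` running over the maximal orders of `D`. [cite: Voight2021, 17.4.1, Lemma 17.4.13 and Cor. 17.4.14] -/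
theorem XiSetup.natCard_typeSet_eq_natCard_conjClasses :
    Nat.card (TypeSet S.O) =
      Nat.card (Set.range fun O' : {O' : Submodule ℤ S.D // IsMaximalOrder S.D O'} =>
        {O'' : Submodule ℤ S.D | SameType O'.1 O''}) := by
  let f : ClassSet S.O → Set.range (fun O' : {O' : Submodule ℤ S.D // IsMaximalOrder S.D O'} =>
      {O'' : Submodule ℤ S.D | SameType O'.1 O''}) := fun c =>
    ⟨{O'' : Submodule ℤ S.D | SameType (leftOrder c.rep) O''}, ⟨⟨leftOrder c.rep, S.isMaximalOrder_leftOrder_rep c⟩, rfl⟩⟩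
  have hf : ∀ c c' : ClassSet S.O, SameType (leftOrder c.rep) (leftOrder c'.rep) → f c = f c' := fun c c' h =>
    Subtype.ext <| Set.ext fun O'' => ⟨fun h'' => h.symm.trans h'', fun h'' => h.trans h''⟩
  let F : TypeSet S.O → Set.range (fun O' : {O' : Submodule ℤ S.D // IsMaximalOrder S.D O'} =>
      {O'' : Submodule ℤ S.D | SameType O'.1 O''}) :=
    Quotient.lift f fun c c' h => hf c c' (typeOf_eq_typeOf_iff.mp (Quotient.sound h))
  have hF : ∀ c, F (typeOf S.O c) = f c := fun c => rfl
  refine Nat.card_congr (Equiv.ofBijective F ⟨?_, ?_⟩)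
  · intro τ τ' hτ
    obtain ⟨c, rfl⟩ := typeOf_surjective τ
    obtain ⟨c', rfl⟩ := typeOf_surjective τ'
    rw [hF, hF] at hτ
    have hsets : {O'' : Submodule ℤ S.D | SameType (leftOrder c.rep) O''} =
        {O'' : Submodule ℤ S.D | SameType (leftOrder c'.rep) O''} := congrArg Subtype.val hτ
    have hmem : leftOrder c'.rep ∈ {O'' : Submodule ℤ S.D | SameType (leftOrder c.rep) O''} := by
      rw [hsets]; exact SameType.refl _
    exact typeOf_eq_typeOf_iff.mpr hmem
  · rintro ⟨s, O', rfl⟩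
    obtain ⟨c, hc⟩ := S.exists_sameType_leftOrder_rep_of_isMaximalOrder O'.2
    refine ⟨typeOf S.O c, ?_⟩
    rw [hF]
    exact Subtype.ext <| Set.ext fun O'' => ⟨fun h'' => hc.symm.trans h'', fun h'' => hc.trans h''⟩

/-- **Type number one ⟺ every maximal order of `D` is conjugate to `O`.** [cite: Voight2021, 17.4.1 and §25.4 (before Thm. 25.4.6)] [cite: VignerasLNM800, Ch. I §4 Cor. 4.11] -/
theorem XiSetup.subsingleton_typeSet_iff_forall_isMaximalOrder :
    Subsingleton (TypeSet S.O) ↔ ∀ O' : Submodule ℤ S.D, IsMaximalOrder S.D O' → SameType S.O O' := by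
  constructor
  · intro h O' hO'
    obtain ⟨c, hc⟩ := S.exists_sameType_leftOrder_rep_of_isMaximalOrder hO'
    exact (S.subsingleton_typeSet_iff.mp h c).trans hc
  · intro h
    exact S.subsingleton_typeSet_iff.mpr fun c => h _ (S.isMaximalOrder_leftOrder_rep c)

/-- **Type number one ⟺ any two maximal orders of `D` are conjugate.** [cite: Voight2021, 17.4.1 and Lemma 17.4.13] -/
theorem XiSetup.subsingleton_typeSet_iff_forall_sameType :
    Subsingleton (TypeSet S.O) ↔
      ∀ O' O'' : Submodule ℤ S.D, IsMaximalOrder S.D O' → IsMaximalOrder S.D O'' → SameType O' O'' := by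
  rw [S.subsingleton_typeSet_iff_forall_isMaximalOrder]
  exact ⟨fun h O' O'' hO' hO'' => (h O' hO').symm.trans (h O'' hO''), fun h O' hO' => h _ _ S.isMaximalOrder_O hO'⟩

/-- `# Typ O = 1 ⟺` every maximal order of `D` is conjugate to `O`. [cite: Voight2021, 17.4.1 and §25.4] -/
theorem XiSetup.natCard_typeSet_eq_one_iff_forall_isMaximalOrder :
    Nat.card (TypeSet S.O) = 1 ↔ ∀ O' : Submodule ℤ S.D, IsMaximalOrder S.D O' → SameType S.O O' := by
  haveI := S.nonempty_classSet
  rw [natCard_typeSet_eq_one_iff, S.subsingleton_typeSet_iff_forall_isMaximalOrder]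

/-- The number of conjugacy classes of maximal orders of `D` is at most the class number `# Cls O`. [cite: Voight2021, Lemma 17.4.13] [cite: VignerasLNM800, Ch. I §4 Cor. 4.11] -/
theorem XiSetup.natCard_conjClasses_le_natCard_classSet :
    Nat.card (Set.range fun O' : {O' : Submodule ℤ S.D // IsMaximalOrder S.D O'} =>
        {O'' : Submodule ℤ S.D | SameType O'.1 O''}) ≤ Nat.card (ClassSet S.O) := by
  rw [← S.natCard_typeSet_eq_natCard_conjClasses]
  exact S.natCard_typeSet_le

end General

/-! ## §2 Prime discriminant: when are all maximal orders conjugate? -/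

section Prime

variable {p : ℕ} [hp : Fact p.Prime] (S : XiSetup 1 p)

/-- **The maximal orders of the definite quaternion algebra of prime discriminant `p` are all conjugate iff
`p ∈ {2, 3, 5, 7, 13}`** (type number one; Deuring's formula rules out every other `p`). [cite: Voight2021, Prop. 30.9.2, Thm. 25.4.1 and §25.4] -/
theorem XiSetup.forall_isMaximalOrder_sameType_iff :
    (∀ O' : Submodule ℤ S.D, IsMaximalOrder S.D O' → SameType S.O O') ↔ (p = 2 ∨ p = 3 ∨ p = 5 ∨ p = 7 ∨ p = 13) := by
  rw [← S.natCard_typeSet_eq_one_iff_forall_isMaximalOrder, S.natCard_typeSet_eq_one_iff_of_prime]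

/-- Pairwise form: **any two maximal orders of `B_{p,∞}` are conjugate iff `p ∈ {2, 3, 5, 7, 13}`.** [cite: Voight2021, Prop. 30.9.2 and §25.4] -/
theorem XiSetup.forall_sameType_iff :
    (∀ O' O'' : Submodule ℤ S.D, IsMaximalOrder S.D O' → IsMaximalOrder S.D O'' → SameType O' O'') ↔
      (p = 2 ∨ p = 3 ∨ p = 5 ∨ p = 7 ∨ p = 13) := by
  rw [← S.subsingleton_typeSet_iff_forall_sameType, S.subsingleton_typeSet_iff_forall_isMaximalOrder,
    S.forall_isMaximalOrder_sameType_iff]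

/-- For `p ∉ {2, 3, 5, 7, 13}` there is a maximal order of `B_{p,∞}` NOT conjugate to `O`. [cite: Voight2021, Prop. 30.9.2] -/
theorem XiSetup.exists_isMaximalOrder_not_sameType (h : ¬(p = 2 ∨ p = 3 ∨ p = 5 ∨ p = 7 ∨ p = 13)) :
    ∃ O' : Submodule ℤ S.D, IsMaximalOrder S.D O' ∧ ¬SameType S.O O' := by
  by_contra hne
  push Not at hne
  exact h (S.forall_isMaximalOrder_sameType_iff.mp fun O' hO' => hne O' hO')

/-- **`24 · # Typ O ≥ p + 11`**: the number of types of maximal orders of `B_{p,∞}` tends to infinity with `p` — from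
`# Cls O < 2 · # Typ O` and Eichler's `12 · # Cls O = p + 13 - 3ρ_p(0,1) - 4ρ_p(1,1) ≥ p - 1`. [cite: Voight2021, Prop. 30.9.2 and Thm. 30.1.5] -/
theorem XiSetup.add_eleven_le_twentyFour_mul_natCard_typeSet : p + 11 ≤ 24 * Nat.card (TypeSet S.O) := by
  have hpp := hp.out
  have h1 := Brandt.XiSetup.twelve_mul_natCard_classSet_add hpp S
  have h2 := rho_le_two hpp 0 1
  have h3 := rho_le_two hpp 1 1
  have h4 := S.natCard_classSet_lt_two_mul_natCard_typeSet
  omega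

/-- The same bound for the number of conjugacy classes of maximal orders of `B_{p,∞}`: it is at least `(p + 11)/24`.
[cite: Voight2021, Prop. 30.9.2 and Thm. 30.1.5] -/
theorem XiSetup.add_eleven_le_twentyFour_mul_natCard_conjClasses :
    p + 11 ≤ 24 * Nat.card (Set.range fun O' : {O' : Submodule ℤ S.D // IsMaximalOrder S.D O'} =>
        {O'' : Submodule ℤ S.D | SameType O'.1 O''}) := by
  rw [← S.natCard_typeSet_eq_natCard_conjClasses]
  exact S.add_eleven_le_twentyFour_mul_natCard_typeSet

/-- **The number of conjugacy classes of maximal orders of `B_{p,∞}` (`p ≥ 5`) is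
`½ # Cls O + ¼ ([h(-p)] + h(-4p))`** — Deuring's formula read on maximal orders. [cite: Voight2021, Prop. 30.9.2 and 17.4.1] -/
theorem XiSetup.natCard_conjClasses_eq_deuring (hp5 : 5 ≤ p) :
    (Nat.card (Set.range fun O' : {O' : Submodule ℤ S.D // IsMaximalOrder S.D O'} =>
        {O'' : Submodule ℤ S.D | SameType O'.1 O''}) : ℚ) =
      (Nat.card (ClassSet S.O) : ℚ) / 2 +
        (((if p % 4 = 3 then BinQF.classNumber (-(p : ℤ)) else 0 : ℕ) : ℚ) + BinQF.classNumber (-(4 * (p : ℤ)))) / 4 := by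
  rw [← S.natCard_typeSet_eq_natCard_conjClasses]
  exact S.natCard_typeSet_eq_deuring hp5

/-- With Eichler's class number formula: the number of conjugacy classes of maximal orders of `B_{p,∞}` (`p ≥ 5`) is
`(p-1)/24 + (1 - (-4/p))/8 + (1 - (-3/p))/6 + ([h(-p)] + h(-4p))/4`. [cite: Voight2021, Prop. 30.9.2 and Thm. 30.1.5] -/
theorem XiSetup.natCard_conjClasses_eq_deuring_eichler (hp5 : 5 ≤ p) :
    (Nat.card (Set.range fun O' : {O' : Submodule ℤ S.D // IsMaximalOrder S.D O'} =>
        {O'' : Submodule ℤ S.D | SameType O'.1 O''}) : ℚ) =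
      ((p : ℚ) - 1) / 24 + (1 - (legendreSym p (-4) : ℚ)) / 8 + (1 - (legendreSym p (-3) : ℚ)) / 6 +
        (((if p % 4 = 3 then BinQF.classNumber (-(p : ℤ)) else 0 : ℕ) : ℚ) + BinQF.classNumber (-(4 * (p : ℤ)))) / 4 := by
  rw [← S.natCard_typeSet_eq_natCard_conjClasses]
  exact S.natCard_typeSet_eq_deuring_eichler hp5

end Prime

/-! ## §3 Examples -/

section Examples

/-- `p = 11`: exactly two conjugacy classes of maximal orders. [cite: Voight2021, Prop. 30.9.2 and Exercise 30.6] -/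
theorem XiSetup.natCard_conjClasses_eleven (S : XiSetup 1 11) :
    Nat.card (Set.range fun O' : {O' : Submodule ℤ S.D // IsMaximalOrder S.D O'} =>
        {O'' : Submodule ℤ S.D | SameType O'.1 O''}) = 2 := by
  rw [← S.natCard_typeSet_eq_natCard_conjClasses]; exact S.natCard_typeSet_eleven

/-- `p = 37`: three right ideal classes but only two conjugacy classes of maximal orders. [cite: Voight2021, Prop. 30.9.2 and Exercise 30.6] -/
theorem XiSetup.natCard_conjClasses_thirtySeven (S : XiSetup 1 37) :
    Nat.card (ClassSet S.O) = 3 ∧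
      Nat.card (Set.range fun O' : {O' : Submodule ℤ S.D // IsMaximalOrder S.D O'} =>
        {O'' : Submodule ℤ S.D | SameType O'.1 O''}) = 2 := by
  rw [← S.natCard_typeSet_eq_natCard_conjClasses]; exact S.natCard_typeSet_thirtySeven

/-- `p = 11`: there are two non-conjugate maximal orders in `B_{11,∞}`. [cite: Voight2021, Prop. 30.9.2 and Exercise 30.6] -/
theorem XiSetup.exists_isMaximalOrder_not_sameType_eleven (S : XiSetup 1 11) :
    ∃ O' : Submodule ℤ S.D, IsMaximalOrder S.D O' ∧ ¬SameType S.O O' := by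
  haveI : Fact (Nat.Prime 11) := ⟨by norm_num⟩
  exact S.exists_isMaximalOrder_not_sameType (by omega)

end Examples

end Brandt

end Literature.NumberTheory.Automorphic
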